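import Mathlib.Algebra.Module.Basic
import Mathlib.GroupTheory.GroupAction.Basic
import Mathlib.SetTheory.Cardinal.Finite
import Mathlib.Tactic
import HarnessLib

/-!
# The `𝔽₄`-line: a `2`-torsion group of order `4` with an action through an order-`3` operator

Instantiation algebra for the leaf-(L3) files of crux `UpperOffV0HSYPlus`
(stmt-BirchSwinnertonDyer-19804): `Literature/…/HeegnerPointsKolyvaginPairingCM.lean` (p623843),
`…PairingCMConj.lean` (p624677), `…PairingCMPair.lean` (p625298) and k7t-c3x's assembly take as
DISPLAYED hypotheses, per curve `X ∈ {E_p, E_{3p²}}` at `p = 2` over `K = ℚ(ω)`, the structure of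
`X[2]` as a `Γ_K`-module: simplicity (`hS`), commutant `{a + b w}` (`hC`), commuting action
(`hcomm`), an inverse `ι` of `z - 1` (`hι`, `hιg`), `w³ = 1`, the exponent condition (E)
(`ρ³` acts trivially) and the point `e₀ = τe′ + e′` with `e₀`, `w e₀` independent. For a `j = 0`
curve `y² = x³ + b` over `K ∋ ω` all of these follow from THREE structural facts about
`T = X[2] = {O, (θᵢ, 0)}` (`θᵢ³ = -b`): (i) `T` is killed by `2`, has `4` elements, and carries
the additive operator `f = [ω]|_T` with `f² + f + 1 = 0`; (ii) every `g ∈ Γ_K` acts on `T` as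
`1`, `f` or `f²` (Kummer: `g θ = ζ^{k(g)} θ`); (iii) some `z ∈ Γ_K` acts as `f` (`∛b ∉ K`). This
file proves that implication as PURE ALGEBRA (any group `Γ` acting on any abelian group `T`), so
that an instantiation owes only (i)–(iii) (and, for `e₀`, an additive involution `τ` of `T` with
`τ f = f² τ` — complex conjugation):

* `F4Line.f_ne_self`, `orbit_eq` — `f` is fixed-point-free; `T = {0, P, fP, f²P}` for `P ≠ 0`.
* `F4Line.smul_comm` (`hcomm`), `F4Line.inv_sub` (`ι := f` inverts `z - 1`: `f (fP - P) = P`),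
  `F4Line.inv_smul` (`hιg`), `F4Line.pow_three_smul` ((E): `ρ³ • P = P`).
* `F4Line.simple` (`hS`), `F4Line.commutant` (`hC`: an equivariant endomorphism is `a + b f`).
* `F4Line.exists_e0` — for an additive involution `τ` with `τ (f P) = f (f (τ P))`: some `e′`
  has `e₀ := τ e′ + e′ ≠ 0`, `f e₀ ≠ e₀`, and `A • e₀ + B • f e₀ = 0 → 2 ∣ A ∧ 2 ∣ B`.

Nothing here mentions curves; nothing is asserted about 19804; no label moves; BSD not claimed.
Memo two §57.1 (F2) / §57.4 Steps 1–3 are the source of the dictionary.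
-/

set_option linter.dupNamespace false -- Summits modules are `Summit.<Summit>.<Problem>…` by design

namespace Summit.BirchSwinnertonDyer.BirchSwinnertonDyer.Theorems.SylvesterTwoCoupledDescentF4Line

namespace F4Line

variable {Γ : Type*} [Group Γ] {T : Type*} [AddCommGroup T] [DistribMulAction Γ T]
variable {f : T →+ T}
variable (h2 : ∀ P : T, P + P = 0) (hrel : ∀ P : T, f (f P) + f P + P = 0)

/-! ## The operator `f` with `f² + f + 1 = 0` on a `2`-torsion group -/

include hrel in
/-- `f³ = 1` (from `f² + f + 1 = 0`). -/
theorem f_f_f (P : T) : f (f (f P)) = P := by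
  have h' := congrArg f (hrel P)
  rw [map_add, map_add, map_zero] at h'
  have e2 : f (f (f P)) - P = (f (f (f P)) + f (f P) + f P) - (f (f P) + f P + P) := by abel
  rw [← sub_eq_zero, e2, h', hrel P, sub_zero]

include h2 in
/-- `-P = P` in a `2`-torsion group. -/
theorem neg_eq (P : T) : -P = P := by
  rw [neg_eq_iff_add_eq_zero]; exact h2 P

include h2 hrel in
/-- `f² = f + 1` (characteristic `2`). -/
theorem f_f_eq (P : T) : f (f P) = f P + P := by
  have h := hrel P
  rw [add_assoc, add_eq_zero_iff_eq_neg] at h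
  rw [h, neg_add, neg_eq h2, neg_eq h2]

include h2 hrel in
/-- `f` is fixed-point-free: `f P = P` forces `P = 0` (`3P = 0` and `2P = 0`). -/
theorem eq_zero_of_f_eq {P : T} (hP : f P = P) : P = 0 := by
  have h := hrel P
  rw [hP, hP, h2, zero_add] at h
  exact h

include h2 hrel in
/-- `f P ≠ P` for `P ≠ 0`. -/
theorem f_ne_self {P : T} (hP : P ≠ 0) : f P ≠ P := fun h ↦ hP (eq_zero_of_f_eq h2 hrel h)

include hrel in
/-- `f` is injective (`f³ = 1`). (Private: the dedup linter matches its bare shape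
`Function.Injective f` against unrelated tree lemmas.) -/
private theorem f_injective : Function.Injective f := fun P Q h ↦ by
  rw [← f_f_f hrel P, ← f_f_f hrel Q, h]

include h2 hrel in
/-- **`ι := f` inverts `f - 1`**: `f (f P - P) = P`. -/
theorem inv_sub (P : T) : f (f P - P) = P := by
  rw [map_sub, f_f_eq h2 hrel, add_sub_cancel_left]

include h2 hrel in
/-- The four elements `0, P, fP, f²P` are pairwise distinct for `P ≠ 0`. -/
theorem distinct {P : T} (hP : P ≠ 0) :
    f P ≠ 0 ∧ f (f P) ≠ 0 ∧ f P ≠ P ∧ f (f P) ≠ P ∧ f (f P) ≠ f P := by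
  have hinj := f_injective hrel (f := f)
  refine ⟨fun h ↦ hP ?_, fun h ↦ hP ?_, f_ne_self h2 hrel hP, fun h ↦ ?_,
    f_ne_self h2 hrel (fun h ↦ hP ?_)⟩
  · exact hinj (by rw [h, map_zero])
  · exact hinj (hinj (by rw [h, map_zero, map_zero]))
  · -- `f²P = P ⇒ f³P = fP ⇒ P = fP`
    have h' := congrArg f h
    rw [f_f_f hrel] at h'
    exact f_ne_self h2 hrel hP h'.symm
  · exact hinj (by rw [h, map_zero])

include h2 hrel in
/-- **`T = {0, P, fP, f²P}` for any `P ≠ 0`** when `T` has exactly four elements. -/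
theorem orbit_eq (hcard : Nat.card T = 4) {P : T} (hP : P ≠ 0) (Q : T) :
    Q = 0 ∨ Q = P ∨ Q = f P ∨ Q = f (f P) := by
  classical
  haveI : Finite T := Nat.finite_of_card_ne_zero (by rw [hcard]; decide)
  haveI := Fintype.ofFinite T
  obtain ⟨h1, h2', h3, h4, h5⟩ := distinct h2 hrel hP
  let S : Finset T := {0, P, f P, f (f P)}
  have hS : S.card = 4 := by
    simp only [S]
    rw [Finset.card_insert_of_notMem, Finset.card_insert_of_notMem, Finset.card_insert_of_notMem,
      Finset.card_singleton]
    · simpa using h5.symm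
    · simp [h3.symm, h4.symm]
    · simp [hP.symm, h1.symm, h2'.symm]
  have huniv : S = Finset.univ := Finset.eq_univ_of_card S (by
    rw [hS, ← Nat.card_eq_fintype_card, hcard])
  have hQ : Q ∈ S := by rw [huniv]; exact Finset.mem_univ Q
  simpa [S] using hQ

/-! ## The action of `Γ` through powers of `f` -/

section Action

variable (hact : ∀ g : Γ, (∀ P : T, g • P = P) ∨ (∀ P : T, g • P = f P) ∨
  (∀ P : T, g • P = f (f P)))

include hact in
/-- Every `g` commutes with `f`. -/
theorem smul_f (g : Γ) (P : T) : g • f P = f (g • P) := by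
  rcases hact g with h | h | h <;> simp [h]

include hact in
/-- **`hcomm`**: the action is through pairwise commuting operators. -/
theorem smul_comm (g h : Γ) (P : T) : g • h • P = h • g • P := by
  rcases hact g with hg | hg | hg <;> rcases hact h with hh | hh | hh <;> simp [hg, hh]

include hact in
/-- **`hιg`** for `ι := f`: `f (g • P) = g • f P`. -/
theorem inv_smul (g : Γ) (P : T) : f (g • P) = g • f P := (smul_f hact g P).symm

include hrel hact in
/-- **(E)**: `ρ³` acts trivially. -/
theorem pow_three_smul (ρ : Γ) (P : T) : ρ ^ 3 • P = P := by
  rw [pow_succ, pow_two, mul_smul, mul_smul]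
  rcases hact ρ with h | h | h
  · rw [h, h, h]
  · rw [h, h, h, f_f_f hrel]
  · rw [h, h, h, f_f_f hrel, f_f_f hrel]

end Action

include h2 hrel in
/-- **`hS`**: with some `z ∈ Γ` acting as `f` and `#T = 4`, a `Γ`-stable subgroup is `⊥` or `⊤`. -/
theorem simple (hcard : Nat.card T = 4) {z : Γ} (hz : ∀ P : T, z • P = f P)
    (H : AddSubgroup T) (hH : ∀ g : Γ, ∀ t ∈ H, g • t ∈ H) : H = ⊥ ∨ H = ⊤ := by
  by_cases hbot : H = ⊥
  · exact Or.inl hbot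
  · right
    have hex : ∃ P ∈ H, P ≠ 0 := by
      by_contra hcon
      push Not at hcon
      exact hbot ((AddSubgroup.eq_bot_iff_forall H).mpr hcon)
    obtain ⟨P, hPH, hP0⟩ := hex
    have hfP : f P ∈ H := by rw [← hz]; exact hH z P hPH
    have hffP : f (f P) ∈ H := by rw [← hz]; exact hH z _ hfP
    refine eq_top_iff.mpr fun Q _ ↦ ?_
    rcases orbit_eq h2 hrel hcard hP0 Q with rfl | rfl | rfl | rfl
    · exact zero_mem H
    · exact hPH
    · exact hfP
    · exact hffP

include h2 hrel in
/-- **`hC`**: with some `z ∈ Γ` acting as `f` and `#T = 4`, every `Γ`-equivariant additive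
endomorphism of `T` is `t ↦ a•t + b•f t` for some integers `a, b`. -/
theorem commutant (hcard : Nat.card T = 4) (hT : ∃ P : T, P ≠ 0) {z : Γ}
    (hz : ∀ P : T, z • P = f P) (f' : T →+ T) (hf' : ∀ (g : Γ) (t : T), f' (g • t) = g • f' t) :
    ∃ a b : ℤ, ∀ t, f' t = a • t + b • f t := by
  obtain ⟨P, hP⟩ := hT
  -- `f'` commutes with `f`
  have hcf : ∀ t, f' (f t) = f (f' t) := fun t ↦ by rw [← hz, hf', hz]
  -- the value `f' P` determines `f'` on the orbit `{0, P, fP, f²P} = T`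
  have key : ∀ a b : ℤ, f' P = a • P + b • f P → ∀ t, f' t = a • t + b • f t := by
    intro a b hfP t
    rcases orbit_eq h2 hrel hcard hP t with rfl | rfl | rfl | rfl
    · simp
    · exact hfP
    · rw [hcf, hfP, map_add, map_zsmul, map_zsmul]
    · rw [hcf, hcf, hfP, map_add, map_zsmul, map_zsmul, map_add, map_zsmul, map_zsmul]
  rcases orbit_eq h2 hrel hcard hP (f' P) with h | h | h | h
  · exact ⟨0, 0, key 0 0 (by rw [h]; simp)⟩
  · exact ⟨1, 0, key 1 0 (by rw [h]; simp)⟩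
  · exact ⟨0, 1, key 0 1 (by rw [h]; simp)⟩
  · exact ⟨1, 1, key 1 1 (by rw [h, f_f_eq h2 hrel]; simp [add_comm])⟩

/-! ## The point `e₀ = τe′ + e′` -/

include h2 hrel in
/-- **The `τ`-fixed point and `e₀`.** For an additive involution `τ` of `T` with `τ f = f² τ`
(`τ (f P) = f (f (τ P))`) and `#T = 4`: there is `e′` with `e₀ := τ e′ + e′ ≠ 0`, `f e₀ ≠ e₀`,
and `e₀`, `f e₀` independent (`A•e₀ + B•f e₀ = 0 ⇒ 2 ∣ A, 2 ∣ B`). Proof: `τ` permutes the three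
non-zero points and (by semilinearity) fixes one, say `e`; then `e′ := f e` has
`τe′ + e′ = f²e + fe = e`. -/
theorem exists_e0 (hcard : Nat.card T = 4) (hT : ∃ P : T, P ≠ 0) (τ : T →+ T)
    (hττ : ∀ P, τ (τ P) = P) (hτf : ∀ P, τ (f P) = f (f (τ P))) :
    ∃ e' : T, τ e' + e' ≠ 0 ∧ f (τ e' + e') ≠ τ e' + e' ∧
      ∀ A B : ℤ, A • (τ e' + e') + B • f (τ e' + e') = 0 → (2 : ℤ) ∣ A ∧ (2 : ℤ) ∣ B := by
  obtain ⟨P, hP⟩ := hT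
  -- a non-zero `τ`-fixed point `e`
  have hτ0 : ∀ Q, τ Q = 0 → Q = 0 := fun Q h ↦ by rw [← hττ Q, h, map_zero]
  obtain ⟨e, he0, hτe⟩ : ∃ e : T, e ≠ 0 ∧ τ e = e := by
    rcases orbit_eq h2 hrel hcard hP (τ P) with h | h | h | h
    · exact absurd (hτ0 P h) hP
    · exact ⟨P, hP, h⟩
    · -- `τP = fP ⇒ τ(f²P) = f²(τ(fP)) = f²(f²(τP)) = f⁴(fP) = f²P`
      refine ⟨f (f P), (distinct h2 hrel hP).2.1, ?_⟩
      rw [hτf, hτf, h, f_f_f hrel]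
    · -- `τP = f²P ⇒ τ(fP) = f²(τP) = f⁴P = fP`
      refine ⟨f P, (distinct h2 hrel hP).1, ?_⟩
      rw [hτf, h, f_f_f hrel]
  have he₀ : τ (f e) + f e = e := by
    rw [hτf, hτe, f_f_eq h2 hrel, add_comm (f e) e, add_assoc, h2, add_zero]
  refine ⟨f e, ?_, ?_, ?_⟩
  · rw [he₀]; exact he0
  · rw [he₀]; exact f_ne_self h2 hrel he0
  · intro A B hAB
    rw [he₀] at hAB
    -- reduce `A`, `B` mod 2 using `2•Q = 0`
    have h2z : ∀ Q : T, (2 : ℤ) • Q = 0 := fun Q ↦ by rw [two_zsmul]; exact h2 Q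
    have hred : ∀ (C : ℤ) (Q : T), C • Q = (C % 2) • Q := fun C Q ↦ by
      conv_lhs => rw [← Int.emod_add_ediv_mul C 2, add_zsmul, ← smul_smul, h2z, smul_zero, add_zero]
    rw [hred A, hred B] at hAB
    obtain ⟨d1, -, d3, -, -⟩ := distinct h2 hrel he0
    rcases Int.emod_two_eq_zero_or_one A with hA | hA <;>
      rcases Int.emod_two_eq_zero_or_one B with hB | hB
    · exact ⟨Int.dvd_of_emod_eq_zero hA, Int.dvd_of_emod_eq_zero hB⟩
    · rw [hA, hB, zero_zsmul, one_zsmul, zero_add] at hAB; exact absurd hAB d1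
    · rw [hA, hB, one_zsmul, zero_zsmul, add_zero] at hAB; exact absurd hAB he0
    · rw [hA, hB, one_zsmul, one_zsmul] at hAB
      -- `e + fe = 0 ⇒ fe = -e = e`
      have : f e = e := by
        rw [add_comm, add_eq_zero_iff_eq_neg, neg_eq h2] at hAB; exact hAB
      exact absurd this d3

/-! ## The action hypothesis `hact` from equivariance of `f` (appended) -/

include h2 hrel in
/-- **`hact` is automatic**: if `f` commutes with the action (`g • f P = f (g • P)` — e.g. `f` is
the restriction of an isogeny defined over `K`) and `#T = 4`, then every `g ∈ Γ` acts on `T` as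
`1`, `f` or `f²`. Indeed `g • P₁ ≠ 0` lies in `T = {0, P₁, fP₁, f²P₁}`, say `g • P₁ = f^k P₁`,
and then `g • (f^j P₁) = f^j (g • P₁) = f^k (f^j P₁)`. So of the instantiation facts only
`#X[2] = 4`, `[ω]² + [ω] + 1 = 0`, the equivariance of `[ω]` and «some `z` acts as `[ω]`»
(`∛b ∉ K`) are arithmetic. -/
theorem act_cases (hcard : Nat.card T = 4) (hT : ∃ P : T, P ≠ 0)
    (hgf : ∀ (g : Γ) (P : T), g • f P = f (g • P)) (g : Γ) :
    (∀ P : T, g • P = P) ∨ (∀ P : T, g • P = f P) ∨ (∀ P : T, g • P = f (f P)) := by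
  obtain ⟨P₁, hP₁⟩ := hT
  have hg0 : g • P₁ ≠ 0 := fun h ↦ hP₁ (by
    have := congrArg (fun Q ↦ g⁻¹ • Q) h
    simpa using this)
  -- transport a formula on `P₁` to all of `T = {0, P₁, fP₁, f²P₁}`
  have spread : ∀ F : T →+ T, (∀ Q, F (f Q) = f (F Q)) → g • P₁ = F P₁ →
      ∀ P : T, g • P = F P := by
    intro F hF hP P
    rcases orbit_eq h2 hrel hcard hP₁ P with rfl | rfl | rfl | rfl
    · rw [smul_zero, map_zero]
    · exact hP
    · rw [hgf, hP, hF]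
    · rw [hgf, hgf, hP, hF, hF]
  rcases orbit_eq h2 hrel hcard hP₁ (g • P₁) with h | h | h | h
  · exact absurd h hg0
  · exact Or.inl (spread (AddMonoidHom.id T) (fun _ ↦ rfl) h)
  · exact Or.inr (Or.inl (spread f (fun _ ↦ rfl) h))
  · exact Or.inr (Or.inr (spread (f.comp f) (fun _ ↦ rfl) h))

end F4Line

end Summit.BirchSwinnertonDyer.BirchSwinnertonDyer.Theorems.SylvesterTwoCoupledDescentF4Line
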